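import Literature.Analysis.FluidPDE.NSLerayBlowupRate
import Literature.Analysis.FluidPDE.KatoLocalBoundedProofs
import Literature.Analysis.FluidPDE.NSBoundedMildAnalytic
import Literature.Analysis.FluidPDE.TaoFiniteEnergyLerayHopf
import Literature.Analysis.FluidPDE.ClassicalBoundedWeak
import Literature.Analysis.FluidPDE.OseenHeatLpBounds
import Literature.Analysis.FluidPDE.MollifiedSolenoidalTest
import HarnessLib

/-!
# Leray's local existence theorem for `L² ∩ L^∞` data: reduction of
# `leray_strong_local_existence` to the smoothing of bounded mild solutions

Analysis/FluidPDE proofs file (everything proved; no definitions, no named facts) for the named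
fact `Literature.Analysis.FluidPDE.leray_strong_local_existence` (`NSLerayBlowupRate.lean`;
Leray 1934, §19 with (3.8); Ożański–Pooley 2018, Thm. 6.22 with Cor. 6.16, Thm. 6.15 and
Lemma 6.21): there is a universal `C > 0` such that for `ν > 0` and a weakly divergence-free
`u₀ ∈ L²(ℝ³)` with `‖u₀‖_{L^∞} ≤ M`, `0 < M`, there is a pair `(v, q)` which is a classical
solution of the unforced Navier–Stokes system on the open time interval `(0, Cν/M²)` and a
Leray–Hopf weak solution from `u₀` on `[0, T']` for every `T' < Cν/M²`. That fact is the only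
hypothesis of the tree's proof of Leray's blow-up rate `leray_blowup_rate_top`
(`leray_blowup_rate_top_of_strong_local_existence`).

## The printed proof and what is proved here

Ożański–Pooley 2018, Thm. 6.22 ("If `u₀ ∈ H ∩ L^∞` … there exists a unique strong solution
`u` … on `[0,T)` with `u(0) = u₀`, where `T > C/‖u₀‖²_∞`") is proved by Leray's successive
approximations `u⁽⁰⁾ = Φ(t) ∗ u₀`, `u⁽ⁿ⁺¹⁾ = u⁽⁰⁾ + ∫₀ᵗ ∇𝒯(t-s) ∗ [u⁽ⁿ⁾u⁽ⁿ⁾] ds` in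
`C([0,T); L²) ∩ C((0,T); L^∞)` ((6.58)–(6.64); Leray 1934, §19, pp. 222–223); a strong solution
is then smooth in the open interval with a pressure (Thm. 6.15, Cor. 6.16; Leray §15,
pp. 218–219) and satisfies the energy equality from `t = 0` (Lemma 6.21, by monotone
convergence from the interior energy equality Thm. 6.17 = Leray's (3.4)), so that it is a
Leray–Hopf ("turbulent") solution (Leray §32, p. 242). In the tree:

* **the iteration** is Oseen's scheme for bounded data in `L^∞ ∩ L^∞_t Lᵖ`
  (`exists_oseen_fixedPoint_bounded`, `KatoLocalBoundedPicard.lean`, here with `p = 2`), and its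
  assembly into a duality-form mild solution in `C([0,T); L³)` with `L^∞` lifespan `c₀ν/M²`
  (`kato_local_bounded_holds`, `KatoLocalBoundedProofs.lean`), re-run here with the `L²` norm
  carried along (`exists_kato_solution_of_memLp_two_of_bound`: the solution is moreover in
  `C([0,T); L²)` with `‖w(t)‖₂ ≤ 2‖u₀‖₂`, `‖w‖ ≤ 2M`; the `C_t L³` clause needs only a uniform `L³`
  bound, obtained by Lebesgue interpolation between `L²` and `L^∞`);
* **the regularity in the open interval** (Thm. 6.15 / Cor. 6.16) is, for bounded mild solutions,
  the tree's named fact `classical_of_bounded_mild_L3` (`MildL3Smooth.lean`; Lemarié-Rieusset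
  2016, Thm. 9.12; Giga 1986; KNSS 2009, Prop. 4.1), itself reduced in the tree to either of the
  leaves `lemarieRieusset2016_local_analyticity` (`classical_of_bounded_mild_L3_of_local_analyticity`,
  `NSBoundedMildAnalytic.lean`) or (L) `knss2009_local_smoothing ℝ³`
  (`classical_of_bounded_mild_L3_of_local`, `MildL3SmoothOfKNSS.lean`) — it is taken as the ONLY
  hypothesis of this file;
* **the Leray–Hopf property** (Lemma 6.21 with Def. 6.20; Leray §17, §32) is proved
  (`isLerayHopfOn_of_classical_Ioo`): the classical representative `wc` on `(0, T)` inherits the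
  pointwise and `L²` bounds; on interior intervals `[s, t] ⊂ (0, T)` its translate is a finite
  energy classical solution on a closed slab, so the tree's unconditional energy equality
  (`energyEq_of_finiteEnergy`, `TaoFiniteEnergyLerayHopf.lean`; Tao 2013, Lemma 8.1 with
  Lemma 4.1 (i)) gives `½‖wc(t)‖₂² + ν∫ₛᵗ∫|∇wc|² = ½‖wc(s)‖₂²` (`energyEq_Ioo`); the dissipation
  is finite up to `t = 0` by exhausting `(0, T')` with `(T'/(n+2), T')`
  (`lintegral_dissipation_Ioo_le`), and the energy equality from `0` follows as `s → 0⁺` from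
  the `L²` continuity at `0` (the velocity being reset to `u₀` at `t = 0`, which keeps it
  classical on the open interval, `IsClassicalNSSolutionOn.congr_velocity`); the weak formulation
  with the datum term is the cut-off argument of the tree (`weakIdentity_datum_of_tested`,
  `LerayHopfRestart.lean`; Robinson–Rodrigo–Sadowski 2016, §3.1) applied to the pressure-free
  identity of the bounded classical solution on the open slab
  (`IsClassicalNSSolutionOn.isBoundedWeakNSSolutionOn`) and the strong attainment of `u₀` in
  `L²`; weak/strong continuity from `C([0,T); L²)`.

Main results:

* `exists_kato_solution_of_memLp_two_of_bound` — the bounded mild solution with `L²` bookkeeping;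
* `IsClassicalNSSolutionOn.energyEq_Ioo`, `IsClassicalNSSolutionOn.lintegral_dissipation_Ioo_le`,
  `isLerayHopfOn_of_classical_Ioo` — the Leray–Hopf structure of a bounded finite-energy
  classical solution on an open time interval, continuous into `L²` at `0⁺`;
* `leray_strong_local_existence_of_classical_of_bounded_mild_L3 :
    classical_of_bounded_mild_L3 → leray_strong_local_existence` — **the reduction**, and its
  compositions with the tree's reductions of the smoothing fact,
  `leray_strong_local_existence_of_local_analyticity`,
  `leray_strong_local_existence_of_knss2009_local_smoothing`, and with the assembly of the
  blow-up rate, `leray_blowup_rate_top_of_classical_of_bounded_mild_L3`.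

The discharge `leray_strong_local_existence_holds` is then the one-line application to
`classical_of_bounded_mild_L3_holds` (equivalently to `lemarieRieusset2016_local_analyticity_holds`
or `knss2009_local_smoothing_holds`) once one of these lands.

## Mathlib / tree search

Tree (`lean search 'kato_local_bounded|exists_oseen_fixedPoint_bounded|classical_of_bounded_mild_L3|
weakIdentity_datum_of_tested|energyEq_of_finiteEnergy|isLerayHopfOn_of_finiteEnergy'`): all the
inputs listed above; `continuousInLpOn_oseen_fixedPoint` (any `p`, `KatoLocalBoundedContinuity`),
`exists_bounded_ae_eq`, `ContinuousInLpOn.congr_ae_slice` (`KatoLocalBoundedProofs`),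
`memLp_of_memLp_of_memLp_top` (`OseenHeatLpBounds`),
`UnboundedOperators.eLpNorm_le_eLpNorm_rpow_mul_eLpNorm_top_rpow`, `norm_le_of_continuous_of_ae_eq`
(`NSBoundedMildSmoothing`), `tendsto_setLIntegral_Ioo_left`, `ContinuousInLpOn.tendsto_kineticEnergy`,
`kineticEnergy_eq_half_toReal_eLpNorm_sq` (`LerayHopfRestartEverywhere`),
`setLIntegral_Ioo_comp_add_right` (`LerayHopfTranslate`), `integrableOn_cylinder_of_lintegral_sq_slab`,
`ae_slice_aestronglyMeasurable_and_lintegral_ball_lt_top` (`DistributionalToWeak`),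
`ContinuousInLpOn.continuousOn_integral_inner`, `tendsto_integral_inner_left_of_tendsto_eLpNorm`
(`MollifiedSolenoidalTest`), `eEnergy_eq_eLpNorm_sq`, `hasWeakGradient_fderiv_of_contDiff`. The
sibling `L^∞` programme of `NSMildDuhamel.lean` / `NSPicardLinfty.lean` (Leray's iteration in the
sup norm for continuous bounded velocities) is an independent construction of the same local
solution; this file uses the older Oseen-kernel stack so as not to duplicate it. Mathlib:
`setLIntegral_iUnion_of_directed`, `tendsto_nhds_unique`, `ENNReal.tendsto_toReal`,
`ENNReal.Tendsto.pow`, `derivWithin_congr`, `Measure.volume_eq_prod`, `Measure.prod_prod`.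

## References

* J. Leray, *Sur le mouvement d'un liquide visqueux emplissant l'espace*, Acta Math. 63 (1934),
  193–248: §15 (pp. 217–219), §17 (3.4), §19 (3.8) (pp. 222–224), §32 (p. 242). [Leray1934]
* W. S. Ożański, B. C. Pooley, *Leray's fundamental work on the Navier–Stokes equations: a modern
  review of "Sur le mouvement d'un liquide visqueux emplissant l'espace"*, in: Partial
  Differential Equations in Fluid Mechanics, LMS Lecture Note Ser. 452, CUP 2018, pp. 113–203
  (arXiv:1708.09787): Def. 6.14, Thm. 6.15, Cor. 6.16, Thm. 6.17, Def. 6.20, Lemma 6.21,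
  Thm. 6.22 with its proof (6.58)–(6.64). [OzanskiPooley2018]
* P. G. Lemarié-Rieusset, *The Navier–Stokes Problem in the 21st Century*, CRC Press 2016,
  Thm. 5.1, §9.9, Thm. 9.12. [LemarieRieusset2016]
* T. Tao, *Localisation and compactness properties of the Navier–Stokes global regularity
  problem*, Anal. PDE 6 (2013) 25–107, Lemma 8.1, Lemma 4.1 (i). [Tao2011]
* J. C. Robinson, J. L. Rodrigo, W. Sadowski, *The three-dimensional Navier–Stokes equations*,
  CUP 2016, §3.1, Cor. 4.8. [RobinsonRodrigoSadowski2016]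
-/

noncomputable section

open MeasureTheory Set Function Filter TopologicalSpace InnerProductSpace Metric
open _root_.Topology
open scoped RealInnerProductSpace NNReal ENNReal Laplacian

namespace Literature.Analysis.FluidPDE

/-! ### Small tools -/

section Tools

variable {α : Type*} [MeasurableSpace α] {μ : Measure α} {G : Type*} [NormedAddCommGroup G]

/-- **Uniform `L³` bound from an `L²` bound and a pointwise bound** (Lebesgue interpolation
`‖f‖₃ ≤ ‖f‖₂^{2/3} ‖f‖_∞^{1/3}`): if `‖f‖ ≤ B` pointwise and `‖f‖₂ ≤ L₂` then
`‖f‖₃ ≤ L₂^{2/3} (ofReal B)^{1/3}`. [folklore] -/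
theorem eLpNorm_three_le_of_eLpNorm_two_le_of_bound {f : α → G} (hf : AEStronglyMeasurable f μ)
    {B : ℝ} (hB : ∀ x, ‖f x‖ ≤ B) {L₂ : ℝ≥0∞} (hL₂ : eLpNorm f 2 μ ≤ L₂) :
    eLpNorm f 3 μ ≤ L₂ ^ (2 / 3 : ℝ) * ENNReal.ofReal B ^ (1 / 3 : ℝ) := by
  have h := UnboundedOperators.eLpNorm_le_eLpNorm_rpow_mul_eLpNorm_top_rpow (μ := μ) hf
    (p := 2) (q := 3) two_ne_zero (by norm_num)
  have h23 : (2 : ℝ≥0∞).toReal / (3 : ℝ≥0∞).toReal = 2 / 3 := by norm_num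
  rw [h23, show (1 : ℝ) - 2 / 3 = 1 / 3 by norm_num] at h
  have htop : eLpNorm f ∞ μ ≤ ENNReal.ofReal B := by
    rw [eLpNorm_exponent_top]
    exact eLpNormEssSup_le_of_ae_bound (Eventually.of_forall hB) |>.trans (by simp)
  refine h.trans ?_
  gcongr

end Tools

/-! ### The bounded mild solution from an `L² ∩ L^∞` datum: Kato class with `L²` bookkeeping -/

section Existence

/-- **The bounded local mild solution from a datum in `L² ∩ L^∞`, with its `L²` bookkeeping**
(Leray 1934, §19, (3.8): successive approximations for bounded data, lifespan `τ = AνV⁻²(0)`;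
Ożański–Pooley 2018, proof of Thm. 6.22, (6.58)–(6.64): the iterates stay in
`C([0,T); L²) ∩ C((0,T); L^∞)` with `‖u⁽ⁿ⁾(t)‖_∞ ≤ 2‖u₀‖_∞`, `‖u⁽ⁿ⁾(t)‖₂ ≤ 2‖u₀‖₂` for
`T ≤ C/‖u₀‖²_∞`; Lemarié-Rieusset 2016, Thm. 5.1 and §9.9: Oseen's scheme in `L^∞` with an
`Lᵖ` norm carried along). There is an absolute `c₀ > 0` such that: for `ν > 0`, `M > 0` and
`u₀ ∈ L²(ℝ³)` weakly divergence free with `‖u₀‖_{L^∞} ≤ M`, on `[0, T)`, `T = c₀ν/M²`, there is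
a Kato solution `w` from `u₀` (duality-form mild solution in `C([0,T); L³)`, `w 0 = u₀`,
measurable on the slab) which is moreover in `C([0,T); L²)`, pointwise bounded by `2M` on
`(0, T)`, with `‖w(t)‖_{L^∞} ≤ 2M` and `‖w(t)‖_{L²} ≤ 2‖u₀‖_{L²}` on `[0, T)`. Proof: the
assembly of the tree's `kato_local_bounded_holds` (`KatoLocalBoundedProofs.lean`) run with the
exponent `p = 2` in Oseen's scheme (`exists_oseen_fixedPoint_bounded`); the uniform `L³` bound
needed for the `C_t L³` clause is Lebesgue interpolation between the `L²` and the pointwise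
bounds, and `u₀ ∈ L³` likewise. [cite: Leray1934, §19 (3.8) pp. 222–223] [cite: OzanskiPooley2018, Thm. 6.22 (proof, (6.58)–(6.64))] [cite: LemarieRieusset2016, Thm. 5.1 (PDF pp. 103–105), §9.9 (p. 260)] -/
theorem exists_kato_solution_of_memLp_two_of_bound :
    ∃ c₀ : ℝ, 0 < c₀ ∧
      ∀ {ν M : ℝ} (_hν : 0 < ν) (_hM : 0 < M) {u₀ : (EuclideanSpace ℝ (Fin 3)) → (EuclideanSpace ℝ (Fin 3))} (_hu₀ : MemLp u₀ 2 volume)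
        (_hdiv : IsWeaklyDivFree u₀) (_hbd : eLpNorm u₀ ∞ volume ≤ ENNReal.ofReal M),
        ∃ w : ℝ → (EuclideanSpace ℝ (Fin 3)) → (EuclideanSpace ℝ (Fin 3)),
          IsKatoSolutionOn (c₀ * ν / M ^ 2) ν u₀ w ∧
            ContinuousInLpOn (Ico 0 (c₀ * ν / M ^ 2)) 2 w ∧
            (∀ t ∈ Ioo 0 (c₀ * ν / M ^ 2), ∀ x, ‖w t x‖ ≤ 2 * M) ∧
            (∀ t ∈ Ico 0 (c₀ * ν / M ^ 2), eLpNorm (w t) ∞ volume ≤ ENNReal.ofReal (2 * M)) ∧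
            ∀ t ∈ Ico 0 (c₀ * ν / M ^ 2), eLpNorm (w t) 2 volume ≤ 2 * eLpNorm u₀ 2 volume := by
  obtain ⟨C, hC, hscheme⟩ :=
    exists_oseen_fixedPoint_bounded (E := (EuclideanSpace ℝ (Fin 3))) (p := 2) (by norm_num) (by norm_num)
  refine ⟨((16 * C)⁻¹) ^ 2, by positivity, ?_⟩
  intro ν M hν hM u₀ hu₀ hdiv hbd
  set T : ℝ := (16 * C)⁻¹ ^ 2 * ν / M ^ 2 with hT_def
  have hT : 0 < T := by positivity
  -- the smallness condition holds with equality
  have hsmall : C * M * ν ^ (-(1 / 2 : ℝ)) * (2 * Real.sqrt T) ≤ 1 / 8 := by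
    have hsqrtT : Real.sqrt T = (16 * C)⁻¹ * Real.sqrt ν / M := by
      rw [hT_def, show (16 * C)⁻¹ ^ 2 * ν / M ^ 2 = ((16 * C)⁻¹ * Real.sqrt ν / M) ^ 2 by
        rw [div_pow, mul_pow, Real.sq_sqrt hν.le]]
      exact Real.sqrt_sq (by positivity)
    have hνν : ν ^ (-(1 / 2 : ℝ)) * Real.sqrt ν = 1 := by
      rw [Real.sqrt_eq_rpow, ← Real.rpow_add hν]
      norm_num
    rw [hsqrtT]
    have : C * M * ν ^ (-(1 / 2 : ℝ)) * (2 * ((16 * C)⁻¹ * Real.sqrt ν / M)) =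
        (ν ^ (-(1 / 2 : ℝ)) * Real.sqrt ν) * (2 * C * M * (16 * C)⁻¹ / M) := by ring
    rw [this, hνν, one_mul]
    field_simp
    norm_num
  -- a bounded representative of the datum
  obtain ⟨b, hbm, hba, hbA⟩ := exists_bounded_ae_eq hu₀.1 hM.le hbd
  have hb2 : MemLp b 2 volume := hu₀.ae_eq hba.symm
  have hb_top : MemLp b ∞ volume :=
    memLp_top_of_bound hbm.aestronglyMeasurable M (Eventually.of_forall hbA)
  have hb3 : MemLp b 3 volume := memLp_of_memLp_of_memLp_top (by norm_num) (by norm_num) hb2 hb_top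
  have hu₀3 : MemLp u₀ 3 volume := hb3.ae_eq hba
  have hbdiv : IsWeaklyDivFree b := hdiv.congr_ae hba.symm
  have heq2 : eLpNorm b 2 volume = eLpNorm u₀ 2 volume := eLpNorm_congr_ae hba
  -- Oseen's scheme with the `L²` norm carried along
  obtain ⟨u, hum, hubd, hu2, husl, hfix⟩ :=
    hscheme hν hT hM hbm.aestronglyMeasurable hbA hb2 hsmall
  have hM2 : (0 : ℝ) ≤ 2 * M := by positivity
  -- the uniform `L³` bound of the slices, by interpolation
  set L₃ : ℝ≥0∞ := (2 * eLpNorm b 2 volume) ^ (2 / 3 : ℝ) * ENNReal.ofReal (2 * M) ^ (1 / 3 : ℝ)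
    with hL₃
  have hL₃t : L₃ ≠ ⊤ :=
    ENNReal.mul_ne_top
      (ENNReal.rpow_ne_top_of_nonneg (by norm_num)
        (ENNReal.mul_ne_top ENNReal.ofNat_ne_top hb2.eLpNorm_ne_top))
      (ENNReal.rpow_ne_top_of_nonneg (by norm_num) ENNReal.ofReal_ne_top)
  have hu3 : ∀ t ∈ Ioo 0 T, eLpNorm (u t) 3 volume ≤ L₃ := fun t ht =>
    eLpNorm_three_le_of_eLpNorm_two_le_of_bound (husl t ht) (hubd t ht) (hu2 t ht)
  -- the solution: `w 0 = u₀`, `w t = u t` for `t > 0`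
  set w : ℝ → (EuclideanSpace ℝ (Fin 3)) → (EuclideanSpace ℝ (Fin 3)) := fun t x => if 0 < t then u t x else u₀ x with hw_def
  set w' : ℝ → (EuclideanSpace ℝ (Fin 3)) → (EuclideanSpace ℝ (Fin 3)) := fun t x => if 0 < t then u t x else b x with hw'_def
  have hw_pos : ∀ {t : ℝ}, 0 < t → w t = u t := fun ht => funext fun x => if_pos ht
  have hw'_pos : ∀ {t : ℝ}, 0 < t → w' t = u t := fun ht => funext fun x => if_pos ht
  have hw_zero : w 0 = u₀ := funext fun x => if_neg (lt_irrefl 0)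
  have hw'_zero : w' 0 = b := funext fun x => if_neg (lt_irrefl 0)
  have hww' : ∀ t ∈ Ico 0 T, w' t =ᵐ[volume] w t := by
    intro t ht
    rcases ht.1.eq_or_lt with h | h
    · rw [← h, hw_zero, hw'_zero]
      exact hba
    · rw [hw_pos h, hw'_pos h]
  -- the slices at positive times: `u t = e^{νtΔ}b - B^ν_0(u,u)(t)`
  have hslice : ∀ {t : ℝ}, t ∈ Ioo 0 T →
      u t = UnboundedOperators.heatExtension b (ν * t) - oseenDuhamel ν 0 u u t := fun ht =>
    funext fun x => hfix _ ht x
  have hU_top : ∀ {t : ℝ}, 0 < t → MemLp (UnboundedOperators.heatExtension b (ν * t)) ∞ volume :=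
    fun ht => UnboundedOperators.memLp_heatExtension_holds hb_top le_top (mul_pos hν ht)
  obtain ⟨C₁, hC₁, hBsup⟩ := exists_norm_oseenDuhamel_le_mul (E := (EuclideanSpace ℝ (Fin 3)))
  have hB_top : ∀ {t : ℝ}, t ∈ Ioo 0 T → MemLp (oseenDuhamel ν 0 u u t) ∞ volume := fun ht =>
    memLp_top_of_bound (aestronglyMeasurable_oseenDuhamel hν hum hum hM2 hubd hubd ht.1 ht.2.le) _
      (Eventually.of_forall fun y => hBsup hν ht.1 hM2 hM2
        (fun τ hτ z => hubd τ ⟨hτ.1, hτ.2.trans ht.2⟩ z) (fun τ hτ z => hubd τ ⟨hτ.1, hτ.2.trans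
            ht.2⟩ z) y)
  -- continuity in `Lᵖ` on `[0, T)` for `p = 2, 3`
  have hcont : ∀ {p : ℝ≥0∞} (_ : 1 ≤ p) (_ : p ≠ ∞) (_ : MemLp b p volume) {L : ℝ≥0}
      (_ : ∀ t ∈ Ioo 0 T, eLpNorm (u t) p volume ≤ L), ContinuousInLpOn (Ico 0 T) p w := by
    intro p hp1 hp hbp L huL
    have h := continuousInLpOn_oseen_fixedPoint (E := (EuclideanSpace ℝ (Fin 3))) hp1 hp hν hbm.aestronglyMeasurable
      hbA hbp hum hM2 hubd (L := L) huL husl hfix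
    exact h.congr_ae_slice hww'
  have hcont2 : ContinuousInLpOn (Ico 0 T) 2 w := by
    refine hcont (by norm_num) (by norm_num) hb2 (L := (2 * eLpNorm b 2 volume).toNNReal)
      fun t ht => ?_
    rw [ENNReal.coe_toNNReal (ENNReal.mul_ne_top ENNReal.ofNat_ne_top hb2.eLpNorm_ne_top)]
    exact hu2 t ht
  have hcont3 : ContinuousInLpOn (Ico 0 T) 3 w := by
    refine hcont (by norm_num) (by norm_num) hb3 (L := L₃.toNNReal) fun t ht => ?_
    rw [ENNReal.coe_toNNReal hL₃t]
    exact hu3 t ht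
  refine ⟨w, ⟨⟨fun t ht => ?_, fun t ht => ?_⟩, hcont3, hw_zero, ?_⟩, hcont2, fun t ht x => ?_,
    fun t ht => ?_, fun t ht => ?_⟩
  · -- weak divergence-freeness of the slices
    rcases ht.1.eq_or_lt with h | h
    · rw [← h, hw_zero]; exact hdiv
    · have htT : t ∈ Ioo 0 T := ⟨h, ht.2⟩
      rw [hw_pos h, hslice htT]
      exact (hbdiv.heatExtension_of_bound hbm.aestronglyMeasurable hbA (mul_pos hν h)).sub le_top
        (isWeaklyDivFree_oseenDuhamel hν hum hum hM2 hubd hubd h ht.2.le) (hU_top h) (hB_top htT)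
  · -- the duality identity from `u₀` at time `t`
    rcases ht.1.eq_or_lt with h | h
    · rw [← h]
      exact isMildNSSolutionFrom_zero_iff.2 fun φ _ _ => by rw [hw_zero]
    · have htT : t ∈ Ioo 0 T := ⟨h, ht.2⟩
      intro φ hφ hφd
      have hφc := hφ.hasCompactSupport
      have hφcont := hφ.contDiff.continuous
      have hφ1 : MemLp φ 1 volume :=
        memLp_one_iff_integrable.2 (hφcont.integrable_of_hasCompactSupport hφc)
      simp only [Pi.zero_apply, inner_zero_left, integral_zero, intervalIntegral.integral_zero,
        add_zero]
      rw [hw_pos h, hslice htT]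
      -- split the pairing of the slice
      have hiU : Integrable (fun x => ⟪UnboundedOperators.heatExtension b (ν * t) x, φ x⟫) volume :=
        integrable_inner_of_memLp_conj (p := ∞) (q := 1) (hU_top h) hφ1
      have hiB : Integrable (fun x => ⟪oseenDuhamel ν 0 u u t x, φ x⟫) volume :=
        integrable_inner_of_memLp_conj (p := ∞) (q := 1) (hB_top htT) hφ1
      have hsplit : ∫ x, ⟪(UnboundedOperators.heatExtension b (ν * t) - oseenDuhamel ν 0 u u t) x,
          φ x⟫ =
          (∫ x, ⟪UnboundedOperators.heatExtension b (ν * t) x, φ x⟫) -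
            ∫ x, ⟪oseenDuhamel ν 0 u u t x, φ x⟫ := by
        rw [← integral_sub hiU hiB]
        refine integral_congr_ae (Eventually.of_forall fun x => ?_)
        simp only [Pi.sub_apply, inner_sub_left]
      rw [hsplit]
      -- the free term: symmetry of the caloric pairing, then `b = u₀` a.e.
      have hfree : ∫ x, ⟪UnboundedOperators.heatExtension b (ν * t) x, φ x⟫ =
          ∫ x, ⟪u₀ x, heatTest ν φ t x⟫ := by
        rw [integral_inner_heatExtension_comm_of_bound hbm.aestronglyMeasurable hbA hφcont hφc
            (mul_pos hν h),
          heatTest_of_pos hν h]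
        refine integral_congr_ae ?_
        filter_upwards [hba] with x hx
        rw [hx]
      -- the Duhamel term in duality form, with `w = u` on `(0, t]`
      have hduh := integral_inner_oseenDuhamel_eq_neg_intervalIntegral hν hum hM2 hubd h ht.2.le
          hφ hφd
      rw [hfree, hduh, sub_neg_eq_add]
      congr 1
      refine intervalIntegral.integral_congr_ae ?_
      refine Eventually.of_forall fun τ hτ => ?_
      rw [uIoc_of_le h.le] at hτ
      simp only [hw_pos hτ.1]
  · -- measurability on the slab: `w = u` there
    refine hum.congr ?_
    filter_upwards [ae_restrict_mem (measurableSet_Ioo.prod MeasurableSet.univ)] with q hq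
    show u q.1 q.2 = w q.1 q.2
    rw [hw_pos (mem_prod.1 hq).1.1]
  · -- the pointwise bound on `(0, T)`
    rw [hw_pos ht.1]
    exact hubd t ht x
  · -- the `L^∞` bound
    rcases ht.1.eq_or_lt with h | h
    · rw [← h, hw_zero]
      exact hbd.trans (ENNReal.ofReal_le_ofReal (by linarith))
    · rw [hw_pos h, eLpNorm_exponent_top]
      exact eLpNormEssSup_le_of_ae_bound (Eventually.of_forall fun x => hubd t ⟨h, ht.2⟩ x)
  · -- the `L²` bound
    rcases ht.1.eq_or_lt with h | h
    · rw [← h, hw_zero]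
      calc eLpNorm u₀ 2 volume = 1 * eLpNorm u₀ 2 volume := (one_mul _).symm
        _ ≤ 2 * eLpNorm u₀ 2 volume := by gcongr; norm_num
    · rw [hw_pos h, ← heq2]
      exact hu2 t ⟨h, ht.2⟩

end Existence

/-! ### Classical solutions on an open time interval: modification off the interval -/

section Congr

variable {E : Type*} [NormedAddCommGroup E] [InnerProductSpace ℝ E] [FiniteDimensional ℝ E]

/-- A classical solution stays classical when the velocity is modified at times outside the
time set `S` (all clauses of `IsClassicalNSSolutionOn` only see the slices `u t`, `t ∈ S`, and
the time derivative *within* `S`). [folklore] -/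
theorem IsClassicalNSSolutionOn.congr_velocity {S : Set ℝ} {ν : ℝ} {f u v : ℝ → E → E}
    {p : ℝ → E → ℝ} (h : IsClassicalNSSolutionOn S ν f u p) (huv : ∀ t ∈ S, v t = u t) :
    IsClassicalNSSolutionOn S ν f v p where
  smooth_velocity :=
    h.smooth_velocity.congr fun z hz => by
      change v z.1 z.2 = u z.1 z.2
      rw [huv z.1 (mem_prod.1 hz).1]
  smooth_pressure := h.smooth_pressure
  momentum t ht x := by
    have h1 : timeDerivWithin S v t x = timeDerivWithin S u t x := by
      simp only [timeDerivWithin]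
      exact derivWithin_congr (fun s hs => by rw [huv s hs]) (by rw [huv t ht])
    rw [h1, huv t ht]
    exact h.momentum t ht x
  divFree t ht := by
    rw [huv t ht]
    exact h.divFree t ht

end Congr

/-! ### Energy on interior intervals for classical solutions on an open time interval -/

section InteriorEnergy

variable {ν T : ℝ} {wc : ℝ → (EuclideanSpace ℝ (Fin 3)) → (EuclideanSpace ℝ (Fin 3))} {q : ℝ → (EuclideanSpace ℝ (Fin 3)) → ℝ} {L : ℝ≥0∞}

/-- `∫ ‖f‖² ≤ L²` from `‖f‖_{L²} ≤ L`. [folklore] -/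
theorem lintegral_enorm_sq_le_sq_of_eLpNorm_le {f : (EuclideanSpace ℝ (Fin 3)) → (EuclideanSpace ℝ (Fin 3))} (h : eLpNorm f 2 volume ≤ L) :
    ∫⁻ x, ‖f x‖ₑ ^ 2 ≤ L ^ 2 := by
  have h' : eEnergy f ≤ L ^ 2 := by
    rw [eEnergy_eq_eLpNorm_sq]
    gcongr
  exact h'

/-- Time translation of a classical solution on `(0, T)` onto a closed slab `[0, T₁]`,
`[s, s + T₁] ⊂ (0, T)` (autonomy, `IsClassicalNSSolutionOn.comp_add_right`). [folklore] -/
theorem IsClassicalNSSolutionOn.translate_Icc_of_Ioo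
    (hcl : IsClassicalNSSolutionOn (Ioo 0 T) ν 0 wc q) {s T₁ : ℝ} (hs : 0 < s) (hT₁ : 0 < T₁)
    (hsT : s + T₁ < T) :
    IsClassicalNSSolutionOn (Icc 0 T₁) ν 0 (fun τ => wc (τ + s)) (fun τ => q (τ + s)) :=
  (hcl.comp_add_right s).mono (fun τ hτ => ⟨by linarith [hτ.1], by linarith [hτ.2]⟩)
    (uniqueDiffOn_Icc hT₁)

/-- **Energy equality on interior intervals** (Leray 1934, (3.4); Ożański–Pooley 2018,
Thm. 6.17: a strong solution on `(0, T)` satisfies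
`‖u(t₂)‖² + 2∫_{t₁}^{t₂} ‖∇u‖² = ‖u(t₁)‖²` for `t₁, t₂ ∈ (0, T)`). For a classical solution
`(wc, q)` of the unforced system on the open interval `(0, T)` (`ν > 0`) with
`sup_{0<t<T} ‖wc(t)‖_{L²} < ∞`, and `0 < s < t < T`: the dissipation `∫ₛᵗ∫|∇wc|²` is finite
and `½‖wc(t)‖₂² + ν∫ₛᵗ∫|∇wc|² = ½‖wc(s)‖₂²`. Proof: the translate `wc(· + s)` is a finite
energy classical solution on the closed slab `[0, t - s]`, to which the tree's unconditional
energy equality for finite energy classical solutions (`energyEq_of_finiteEnergy`, Tao 2013,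
Lemma 8.1 with Lemma 4.1 (i), all inputs discharged) applies. [cite: OzanskiPooley2018, Thm. 6.17] [cite: Leray1934, §17 (3.4)] -/
theorem IsClassicalNSSolutionOn.energyEq_Ioo (hcl : IsClassicalNSSolutionOn (Ioo 0 T) ν 0 wc q)
    (hν : 0 < ν) (hLt : L ≠ ⊤) (hL : ∀ t ∈ Ioo 0 T, eLpNorm (wc t) 2 volume ≤ L) {s t : ℝ}
    (hs : 0 < s) (hst : s < t) (htT : t < T) :
    (∫⁻ τ in Ioo s t, ∫⁻ x, ENNReal.ofReal (frobeniusNormSq (fderiv ℝ (wc τ) x))) < ⊤ ∧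
      VectorCalculus.kineticEnergy (wc t) +
          ν * (∫⁻ τ in Ioo s t, ∫⁻ x, ENNReal.ofReal (frobeniusNormSq (fderiv ℝ (wc τ) x))).toReal =
        VectorCalculus.kineticEnergy (wc s) := by
  have hts : 0 < t - s := sub_pos.2 hst
  have h' : IsClassicalNSSolutionOn (Icc 0 (t - s)) ν 0 (fun τ => wc (τ + s))
      (fun τ => q (τ + s)) :=
    hcl.translate_Icc_of_Ioo hs hts (by linarith)
  have hfe : ∃ A : ℝ≥0∞, A < ⊤ ∧ ∀ τ ∈ Icc 0 (t - s), ∫⁻ x, ‖wc (τ + s) x‖ₑ ^ 2 ≤ A :=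
    ⟨L ^ 2, (ENNReal.pow_ne_top hLt).lt_top, fun τ hτ =>
      lintegral_enorm_sq_le_sq_of_eLpNorm_le (hL _ ⟨by linarith [hτ.1], by linarith [hτ.2]⟩)⟩
  obtain ⟨A, hAt, hA, -, hgrad⟩ :=
    h'.energyClass_of_finiteEnergy tao_finite_energy_smooth_energy_bound_holds hν hts hfe
  have hu₃ := h'.lintegral_enorm_pow_three_lt_top hAt hA hgrad
  have hE := h'.energyEq_of_finiteEnergy tao_pressure_normalisation_holds
    tao2011_pressureTerm_estimate_holds hν hts hAt hA hgrad hu₃ le_rfl hts.le le_rfl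
  -- un-translate
  have hshift : ∫⁻ τ in Ioo 0 (t - s), ∫⁻ x,
        ENNReal.ofReal (frobeniusNormSq (fderiv ℝ (wc (τ + s)) x)) =
      ∫⁻ τ in Ioo s t, ∫⁻ x, ENNReal.ofReal (frobeniusNormSq (fderiv ℝ (wc τ) x)) := by
    have h1 := setLIntegral_Ioo_comp_add_right
      (fun τ => ∫⁻ x, ENNReal.ofReal (frobeniusNormSq (fderiv ℝ (wc τ) x))) 0 (t - s) s
    simpa only [zero_add, sub_add_cancel] using h1
  simp only [sub_add_cancel, zero_add] at hE
  rw [hshift] at hE hgrad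
  exact ⟨hgrad, hE⟩

/-- **The dissipation is finite up to the initial time** (Ożański–Pooley 2018, Lemma 6.21:
`‖u(t)‖² + 2∫₀ᵗ‖∇u‖² = ‖u₀‖²` "by taking the limit `t₁ → 0⁺` … and applying the Monotone
Convergence Theorem"). For a classical solution on `(0, T)` with `‖wc(t)‖_{L²} ≤ L` and
`0 < T' < T`: `∫₀^{T'}∫|∇wc|² ≤ L²/(2ν)` — on each `(s, T')` by the energy equality,
`ν∫ₛ^{T'}∫|∇wc|² ≤ ½‖wc(s)‖₂² ≤ ½L²`, and `(0, T') = ⋃ₙ (T'/(n+2), T')`. [cite: OzanskiPooley2018, Lemma 6.21] -/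
theorem IsClassicalNSSolutionOn.lintegral_dissipation_Ioo_le
    (hcl : IsClassicalNSSolutionOn (Ioo 0 T) ν 0 wc q) (hν : 0 < ν) (hLt : L ≠ ⊤)
    (hL : ∀ t ∈ Ioo 0 T, eLpNorm (wc t) 2 volume ≤ L) {T' : ℝ} (hT' : 0 < T') (hT'T : T' < T) :
    ∫⁻ τ in Ioo 0 T', ∫⁻ x, ENNReal.ofReal (frobeniusNormSq (fderiv ℝ (wc τ) x)) ≤
      ENNReal.ofReal (L.toReal ^ 2 / (2 * ν)) := by
  set D : ℝ → ℝ≥0∞ := fun τ => ∫⁻ x, ENNReal.ofReal (frobeniusNormSq (fderiv ℝ (wc τ) x))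
    with hD_def
  -- the bound on every `(s, T')`
  have hsb : ∀ s ∈ Ioo 0 T', ∫⁻ τ in Ioo s T', D τ ≤ ENNReal.ofReal (L.toReal ^ 2 / (2 * ν)) := by
    intro s hs
    obtain ⟨hfin, hE⟩ := hcl.energyEq_Ioo hν hLt hL hs.1 hs.2 hT'T
    have hsT : s ∈ Ioo 0 T := ⟨hs.1, hs.2.trans hT'T⟩
    have hmem : MemLp (wc s) 2 volume :=
      ⟨(hcl.contDiff_velocity hsT).continuous.aestronglyMeasurable,
        (hL s hsT).trans_lt hLt.lt_top⟩
    have hEs : VectorCalculus.kineticEnergy (wc s) ≤ L.toReal ^ 2 / 2 := by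
      rw [kineticEnergy_eq_half_toReal_eLpNorm_sq hmem]
      have h1 : (eLpNorm (wc s) 2 volume).toReal ≤ L.toReal := ENNReal.toReal_mono hLt (hL s hsT)
      have h2 : 0 ≤ (eLpNorm (wc s) 2 volume).toReal := ENNReal.toReal_nonneg
      nlinarith
    have hKt : 0 ≤ VectorCalculus.kineticEnergy (wc T') := kineticEnergy_nonneg _
    have hreal : (∫⁻ τ in Ioo s T', D τ).toReal ≤ L.toReal ^ 2 / (2 * ν) := by
      rw [le_div_iff₀ (by positivity)]
      have : ν * (∫⁻ τ in Ioo s T', D τ).toReal ≤ L.toReal ^ 2 / 2 := by linarith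
      nlinarith
    calc ∫⁻ τ in Ioo s T', D τ = ENNReal.ofReal (∫⁻ τ in Ioo s T', D τ).toReal :=
          (ENNReal.ofReal_toReal hfin.ne).symm
      _ ≤ ENNReal.ofReal (L.toReal ^ 2 / (2 * ν)) := ENNReal.ofReal_le_ofReal hreal
  -- exhaustion of `(0, T')` by the intervals `(T'/(n+2), T')`
  have hunion : Ioo 0 T' = ⋃ n : ℕ, Ioo (T' / (n + 2)) T' := by
    ext τ
    simp only [mem_iUnion, mem_Ioo]
    constructor
    · rintro ⟨hτ0, hτT⟩
      obtain ⟨n, hn⟩ := exists_nat_gt (T' / τ)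
      refine ⟨n, ?_, hτT⟩
      rw [div_lt_iff₀ (by positivity)]
      rw [div_lt_iff₀ hτ0] at hn
      nlinarith
    · rintro ⟨n, hn, hτT⟩
      exact ⟨lt_trans (by positivity) hn, hτT⟩
  have hdir : Directed (· ⊆ ·) (fun n : ℕ => Ioo (T' / (n + 2)) T') := by
    refine Monotone.directed_le fun m n hmn => Ioo_subset_Ioo_left ?_
    exact div_le_div_of_nonneg_left hT'.le (by positivity) (by
      have : (m : ℝ) ≤ n := Nat.cast_le.2 hmn
      linarith)
  rw [hunion, setLIntegral_iUnion_of_directed _ hdir]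
  refine iSup_le fun n => hsb _ ⟨by positivity, ?_⟩
  exact div_lt_self hT' (by
    have : (0 : ℝ) ≤ n := n.cast_nonneg
    linarith)

end InteriorEnergy

/-! ### The Leray–Hopf structure of the local solution -/

section LerayHopfStructure

/-- **The classical solution on `(0, T)`, continuous into `L²` at `t = 0⁺`, is a Leray–Hopf
weak solution from its datum on every `[0, T']`, `T' < T`** (Ożański–Pooley 2018, Lemma 6.21
(energy equality from `0`) with Def. 6.20 and Cor. 6.16; Leray 1934, §17 (3.4) and §32: "toute
solution régulière constitue a fortiori une solution turbulente"). Let `(wc, q)` be a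
classical solution of the unforced system on the open interval `(0, T)`, `ν > 0`, bounded
(`‖wc‖ ≤ B`) with `‖wc(t)‖_{L²} ≤ L < ∞` there; let `v = wc` on `(0, T)`, `v(0) = u₀ ∈ L²`, and
`v ∈ C([0, T); L²)`. Then `v` is a Leray–Hopf weak solution on `[0, T')` from `u₀` for every
`0 < T' < T`: the weak formulation with the datum term is the cut-off argument
(`weakIdentity_datum_of_tested`; Robinson–Rodrigo–Sadowski 2016, §3.1) applied to the
pressure-free identity of the bounded classical solution on the open slab
(`IsClassicalNSSolutionOn.isBoundedWeakNSSolutionOn`) and the strong `L²` attainment of `u₀`;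
the energy inequalities are equalities — on interior intervals by `energyEq_Ioo`, and from
`t = 0` by letting `s → 0⁺` (`E(v(s)) → E(u₀)` by the `L²` continuity, the dissipation integral
by monotone convergence); weak and strong continuity from `v ∈ C([0, T); L²)`. [cite: OzanskiPooley2018, Lemma 6.21 with Def. 6.20 and Cor. 6.16] [cite: Leray1934, §17 (3.4), §32 p. 242] -/
theorem isLerayHopfOn_of_classical_Ioo {ν T T' B : ℝ} {L : ℝ≥0∞} (hν : 0 < ν) (hT' : 0 < T')
    (hT'T : T' < T) {wc v : ℝ → (EuclideanSpace ℝ (Fin 3)) → (EuclideanSpace ℝ (Fin 3))} {q : ℝ → (EuclideanSpace ℝ (Fin 3)) → ℝ} {u₀ : (EuclideanSpace ℝ (Fin 3)) → (EuclideanSpace ℝ (Fin 3))}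
    (hcl : IsClassicalNSSolutionOn (Ioo 0 T) ν 0 wc q) (hvw : ∀ t ∈ Ioo 0 T, v t = wc t)
    (hv0 : v 0 = u₀) (hu₀ : MemLp u₀ 2 volume) (hvc : ContinuousInLpOn (Ico 0 T) 2 v)
    (hB : ∀ t ∈ Ioo 0 T, ∀ x, ‖wc t x‖ ≤ B) (hLt : L ≠ ⊤)
    (hL : ∀ t ∈ Ioo 0 T, eLpNorm (wc t) 2 volume ≤ L) :
    IsLerayHopfOn T' ν 0 u₀ v := by
  have hT : 0 < T := hT'.trans hT'T
  set D : ℝ → ℝ≥0∞ := fun τ => ∫⁻ x, ENNReal.ofReal (frobeniusNormSq (fderiv ℝ (wc τ) x))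
    with hD_def
  have hIoo : ∀ {t : ℝ}, t ∈ Ioo 0 T' → t ∈ Ioo 0 T := fun ht => ⟨ht.1, ht.2.trans hT'T⟩
  have hfilter : 𝓝[>] (0 : ℝ) ≤ 𝓝[Ico 0 T] 0 :=
    nhdsWithin_le_of_mem (mem_of_superset (Ioo_mem_nhdsGT hT) Ioo_subset_Ico_self)
  -- the slices
  have hmem : ∀ t ∈ Ioo 0 T, MemLp (wc t) 2 volume := fun t ht =>
    ⟨(hcl.contDiff_velocity ht).continuous.aestronglyMeasurable, (hL t ht).trans_lt hLt.lt_top⟩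
  have hmemv : ∀ t ∈ Icc 0 T', MemLp (v t) 2 volume := by
    intro t ht
    rcases ht.1.eq_or_lt with h | h
    · rw [← h, hv0]
      exact hu₀
    · have htT : t ∈ Ioo 0 T := ⟨h, ht.2.trans_lt hT'T⟩
      rw [hvw t htT]
      exact hmem t htT
  -- the classical solution on the shorter open interval is a bounded weak solution there
  have hcl' : IsClassicalNSSolutionOn (Ioo 0 T') ν 0 wc q :=
    hcl.mono (Ioo_subset_Ioo_right hT'T.le) isOpen_Ioo.uniqueDiffOn
  have hbw := hcl'.isBoundedWeakNSSolutionOn ⟨B, fun t ht x => hB t (hIoo ht) x⟩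
  -- measurability of `v` on the slab
  have hcont : ContinuousOn (uncurry wc) (Ioo 0 T' ×ˢ univ) := hcl'.smooth_velocity.continuousOn
  have hmeas : AEStronglyMeasurable (uncurry v) (volume.restrict (Ioo 0 T' ×ˢ univ)) := by
    refine (hcont.aestronglyMeasurable (measurableSet_Ioo.prod MeasurableSet.univ)).congr ?_
    filter_upwards [ae_restrict_mem (measurableSet_Ioo.prod MeasurableSet.univ)] with z hz
    change wc z.1 z.2 = v z.1 z.2
    rw [hvw z.1 (hIoo (mem_prod.1 hz).1)]
  -- local square integrability on the cylinders `(0, T') × K`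
  have hB0 : 0 ≤ B := (norm_nonneg _).trans (hB (T' / 2) ⟨by positivity, by linarith⟩ 0)
  have hL2loc : ∀ K : Set (EuclideanSpace ℝ (Fin 3)), IsCompact K → ∫⁻ z in Ioo 0 T' ×ˢ K, ‖uncurry v z‖ₑ ^ 2 < ∞ := by
    intro K hK
    calc ∫⁻ z in Ioo 0 T' ×ˢ K, ‖uncurry v z‖ₑ ^ 2
        ≤ ∫⁻ _ in Ioo 0 T' ×ˢ K, ENNReal.ofReal B ^ 2 := by
          refine setLIntegral_mono' (measurableSet_Ioo.prod hK.measurableSet) fun z hz => ?_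
          have hz1 : z.1 ∈ Ioo 0 T' := (mem_prod.1 hz).1
          change ‖v z.1 z.2‖ₑ ^ 2 ≤ ENNReal.ofReal B ^ 2
          rw [hvw z.1 (hIoo hz1)]
          gcongr
          rw [← ofReal_norm]
          exact ENNReal.ofReal_le_ofReal (hB _ (hIoo hz1) _)
      _ < ∞ := by
          rw [setLIntegral_const, Measure.volume_eq_prod, Measure.prod_prod]
          exact ENNReal.mul_lt_top (ENNReal.pow_ne_top ENNReal.ofReal_ne_top).lt_top
            (ENNReal.mul_lt_top measure_Ioo_lt_top hK.measure_lt_top)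
  -- the divergence constraint
  have hdivae : ∀ᵐ t ∂(volume.restrict (Ioo 0 T')), IsWeaklyDivFree (v t) :=
    (ae_restrict_iff' measurableSet_Ioo).2 (Eventually.of_forall fun t ht => by
      rw [hvw t (hIoo ht)]
      exact VectorCalculus.IsDivFree.isWeaklyDivFree_holds (hcl.divFree t (hIoo ht))
        (contDiff_infty.1 (hcl.contDiff_velocity (hIoo ht)) 1))
  -- strong `L²` attainment of the datum
  have h0 : Tendsto (fun t => eLpNorm (v t - u₀) 2 volume) (𝓝[>] 0) (𝓝 0) := by
    have h1 := hvc.2 0 (left_mem_Ico.2 hT)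
    rw [hv0] at h1
    exact h1.mono_left hfilter
  -- the weak formulation with the datum term
  have hweak : IsWeakNSSolutionOn T' ν 0 u₀ v := by
    refine ⟨hmeas, hL2loc, hdivae, fun ψ hψ hψdiv => ?_⟩
    have hUK := fun K (hK : IsCompact K) =>
      integrableOn_cylinder_of_lintegral_sq_slab hmeas hL2loc hK
    have hgood := ae_slice_aestronglyMeasurable_and_lintegral_ball_lt_top hmeas hL2loc
    have hmom : ∀ φ : ℝ → (EuclideanSpace ℝ (Fin 3)) → (EuclideanSpace ℝ (Fin 3)), IsSpaceTimeTestOn (slab (EuclideanSpace ℝ (Fin 3)) (Ioo 0 T') isOpen_Ioo) φ →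
        (∀ t, VectorCalculus.IsDivFree (φ t)) →
        ∫ t in Ioo 0 T', ∫ x, (⟪v t x, timeDeriv φ t x⟫ + ⟪v t x, convect (v t) (φ t) x⟫ +
          ν * ⟪v t x, Δ (φ t) x⟫ + ⟪(0 : ℝ → (EuclideanSpace ℝ (Fin 3)) → (EuclideanSpace ℝ (Fin 3))) t x, φ t x⟫) = 0 := by
      intro φ hφ hφdiv
      have key := hbw.2.2.2 φ hφ hφdiv
      calc ∫ t in Ioo 0 T', ∫ x, (⟪v t x, timeDeriv φ t x⟫ + ⟪v t x, convect (v t) (φ t) x⟫ +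
              ν * ⟪v t x, Δ (φ t) x⟫ + ⟪(0 : ℝ → (EuclideanSpace ℝ (Fin 3)) → (EuclideanSpace ℝ (Fin 3))) t x, φ t x⟫)
          = ∫ t in Ioo 0 T', ∫ x, (⟪wc t x, timeDeriv φ t x⟫ +
              ⟪wc t x, convect (wc t) (φ t) x⟫ + ν * ⟪wc t x, Δ (φ t) x⟫) := by
            refine setIntegral_congr_fun measurableSet_Ioo fun t ht => ?_
            simp only [hvw t (hIoo ht), Pi.zero_apply, inner_zero_left, add_zero]
        _ = 0 := key
    have h₀ : ∀ K : Set (EuclideanSpace ℝ (Fin 3)), IsCompact K →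
        Tendsto (fun t => ∫⁻ x in K, ‖v t x - u₀ x‖ₑ ^ 2) (𝓝[>] 0) (𝓝 0) := by
      intro K _
      have hsq : Tendsto (fun t => eLpNorm (v t - u₀) 2 volume ^ 2) (𝓝[>] 0) (𝓝 0) := by
        simpa using ENNReal.Tendsto.pow (n := 2) h0
      refine tendsto_of_tendsto_of_tendsto_of_le_of_le tendsto_const_nhds hsq
        (fun _ => zero_le) fun t => ?_
      calc ∫⁻ x in K, ‖v t x - u₀ x‖ₑ ^ 2 ≤ ∫⁻ x, ‖(v t - u₀) x‖ₑ ^ 2 :=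
            setLIntegral_le_lintegral _ _
        _ = eLpNorm (v t - u₀) 2 volume ^ 2 := eEnergy_eq_eLpNorm_sq _
    have hf0 : ∀ K : Set (EuclideanSpace ℝ (Fin 3)), IsCompact K →
        IntegrableOn (uncurry (0 : ℝ → (EuclideanSpace ℝ (Fin 3)) → (EuclideanSpace ℝ (Fin 3)))) (Ioo 0 T' ×ˢ K) volume := fun K _ =>
      integrableOn_zero
    exact weakIdentity_datum_of_tested (f := 0) hT' hUK hmom hf0 hgood hu₀.1 h₀ hψ hψdiv
  -- the dissipation is finite on `(0, T')`
  have hdiss : ∫⁻ τ in Ioo 0 T', D τ ≤ ENNReal.ofReal (L.toReal ^ 2 / (2 * ν)) :=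
    hcl.lintegral_dissipation_Ioo_le hν hLt hL hT' hT'T
  have hDfin : ∫⁻ τ in Ioo 0 T', D τ < ⊤ := hdiss.trans_lt ENNReal.ofReal_lt_top
  -- the energy equality from `t = 0`
  have hEq0 : ∀ t ∈ Ioc 0 T', VectorCalculus.kineticEnergy (v t) +
      ν * (∫⁻ τ in Ioo 0 t, D τ).toReal = VectorCalculus.kineticEnergy u₀ := by
    intro t ht
    have htT : t ∈ Ioo 0 T := ⟨ht.1, ht.2.trans_lt hT'T⟩
    have h1 : Tendsto (fun s => ∫⁻ τ in Ioo s t, D τ) (𝓝[>] 0) (𝓝 (∫⁻ τ in Ioo 0 t, D τ)) :=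
      tendsto_setLIntegral_Ioo_left le_rfl ht.2 hDfin
    have hfin : ∫⁻ τ in Ioo 0 t, D τ ≠ ⊤ :=
      ((lintegral_mono_set (Ioo_subset_Ioo_right ht.2)).trans_lt hDfin).ne
    have h2 : Tendsto (fun s => (∫⁻ τ in Ioo s t, D τ).toReal) (𝓝[>] 0)
        (𝓝 (∫⁻ τ in Ioo 0 t, D τ).toReal) :=
      (ENNReal.tendsto_toReal hfin).comp h1
    have h3 : Tendsto (fun s => VectorCalculus.kineticEnergy (v t) + ν * (∫⁻ τ in Ioo s t, D τ).toReal)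
        (𝓝[>] 0) (𝓝 (VectorCalculus.kineticEnergy (v t) + ν * (∫⁻ τ in Ioo 0 t, D τ).toReal)) :=
      tendsto_const_nhds.add (h2.const_mul ν)
    have h4 : Tendsto (fun s => VectorCalculus.kineticEnergy (v s)) (𝓝[>] 0)
        (𝓝 (VectorCalculus.kineticEnergy u₀)) := by
      have h5 := hvc.tendsto_kineticEnergy (left_mem_Ico.2 hT)
      rw [hv0] at h5
      exact h5.mono_left hfilter
    have heq : (fun s => VectorCalculus.kineticEnergy (v t) + ν * (∫⁻ τ in Ioo s t, D τ).toReal)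
        =ᶠ[𝓝[>] 0] fun s => VectorCalculus.kineticEnergy (v s) := by
      filter_upwards [Ioo_mem_nhdsGT ht.1] with s hs
      rw [hvw t htT, hvw s ⟨hs.1, hs.2.trans htT.2⟩]
      exact (hcl.energyEq_Ioo hν hLt hL hs.1 hs.2 htT.2).2
    exact tendsto_nhds_unique (h3.congr' heq) h4
  -- no force
  have hz : ∀ a b : ℝ, ∫ τ in a..b, ∫ x, ⟪(0 : ℝ → (EuclideanSpace ℝ (Fin 3)) → (EuclideanSpace ℝ (Fin 3))) τ x, v τ x⟫ = 0 := by
    intro a b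
    simp
  have hvc' : ContinuousInLpOn (Icc 0 T') 2 v := hvc.mono (Icc_subset_Ico_right hT'T)
  refine ⟨hweak, ⟨(L ^ 2).toNNReal, ?_⟩, hmemv,
    ⟨fun t => fderiv ℝ (wc t), ?_, hDfin, fun t ht => ?_, ?_⟩, fun w hw => ⟨?_, ?_⟩, h0⟩
  · -- the `L^∞_t L²_x` bound
    refine (ae_restrict_iff' measurableSet_Ioo).2 (Eventually.of_forall fun t ht => ?_)
    rw [ENNReal.coe_toNNReal (ENNReal.pow_ne_top hLt), hvw t (hIoo ht), eEnergy_eq_eLpNorm_sq]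
    gcongr
    exact hL t (hIoo ht)
  · -- the classical gradient is a weak gradient
    refine (ae_restrict_iff' measurableSet_Ioo).2 (Eventually.of_forall fun t ht => ?_)
    rw [hvw t (hIoo ht)]
    exact hasWeakGradient_fderiv_of_contDiff
      (contDiff_infty.1 (hcl.contDiff_velocity (hIoo ht)) 1)
  · -- the energy (in)equality from `0`
    rw [hz, add_zero]
    rcases ht.1.eq_or_lt with h | h
    · rw [← h, hv0]
      simp
    · exact (hEq0 t ⟨h, ht.2⟩).le
  · -- the energy (in)equality from every `s ∈ (0, T')`
    refine (ae_restrict_iff' measurableSet_Ioo).2 (Eventually.of_forall fun s hs t ht => ?_)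
    rw [hz, add_zero]
    rcases ht.1.eq_or_lt with h | h
    · rw [← h]
      simp
    · rw [hvw t ⟨hs.1.trans h, ht.2.trans_lt hT'T⟩, hvw s (hIoo hs)]
      exact (hcl.energyEq_Ioo hν hLt hL hs.1 h (ht.2.trans_lt hT'T)).2.le
  · -- weak continuity on `(0, T']`
    exact (hvc'.continuousOn_integral_inner hw).mono Ioc_subset_Icc_self
  · -- weak attainment of the datum
    refine tendsto_integral_inner_left_of_tendsto_eLpNorm hw ?_ hu₀ h0
    filter_upwards [Ioo_mem_nhdsGT hT'] with t ht
    exact hmemv t ⟨ht.1.le, ht.2.le⟩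

end LerayHopfStructure

/-! ### The reduction and the assembly -/

section Assembly

/-- **Leray's local existence theorem for `L² ∩ L^∞` data from the smoothing of bounded mild
solutions** (`classical_of_bounded_mild_L3 → leray_strong_local_existence`). Leray 1934, §19
with (3.8) (existence of the *solution régulière* for `0 ≤ t < τ = AνV⁻²(0)`), §15 (regularity
in the interior), §17 (3.4) (energy equality), §32 (regular solutions are turbulent solutions);
Ożański–Pooley 2018, Thm. 6.22 with Cor. 6.16, Thm. 6.15 and Lemma 6.21. Proof: Oseen's scheme
for the bounded representative of `u₀` in `L^∞ ∩ L^∞_t L²` on `[0, c₀ν/M²)`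
(`exists_kato_solution_of_memLp_two_of_bound`: a Kato solution, bounded by `2M`, in
`C([0,T); L²)` with `‖w(t)‖₂ ≤ 2‖u₀‖₂`); by the smoothing fact the bounded mild solution has a
classical representative `(wc, q)` on `(0, T)` (`classical_of_bounded_mild_L3`; Leray §15 /
Ożański–Pooley Thm. 6.15, Cor. 6.16); the pointwise and `L²` bounds pass to the continuous
representative; resetting the velocity to `u₀` at `t = 0` keeps it classical on `(0, T)`
(`IsClassicalNSSolutionOn.congr_velocity`) and continuous into `L²` on `[0, T)`, whence
Leray–Hopf from `u₀` on every `[0, T']`, `T' < T` (`isLerayHopfOn_of_classical_Ioo`). The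
constant is `C = c₀`. [cite: Leray1934, §19 (3.8) pp. 222–224; §15, §17 (3.4), §32] [cite: OzanskiPooley2018, Thm. 6.22 with Cor. 6.16, Thm. 6.15, Lemma 6.21] -/
theorem leray_strong_local_existence_of_classical_of_bounded_mild_L3
    (hC : classical_of_bounded_mild_L3) : leray_strong_local_existence := by
  obtain ⟨c₀, hc₀, hkato⟩ := exists_kato_solution_of_memLp_two_of_bound
  refine ⟨c₀, hc₀, ?_⟩
  intro ν hν u₀ M hM hu₀ hdiv hbd
  set T : ℝ := c₀ * ν / M ^ 2 with hT_def
  have hT : 0 < T := by positivity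
  obtain ⟨w, hK, hwc2, -, hwtop, hwL2⟩ := hkato hν hM hu₀ hdiv hbd
  -- the datum is in `L³`
  have hu₀3 : MemLp u₀ 3 volume :=
    memLp_of_memLp_of_memLp_top (by norm_num) (by norm_num) hu₀
      ⟨hu₀.1, hbd.trans_lt ENNReal.ofReal_lt_top⟩
  -- the classical representative of the bounded mild solution
  have hbdd : ∀ δ T₁ : ℝ, 0 < δ → δ < T₁ → T₁ < T →
      ∃ C : ℝ, ∀ t ∈ Ioo δ T₁, eLpNorm (w t) ∞ volume ≤ ENNReal.ofReal C :=
    fun δ T₁ hδ _ hT₁ => ⟨2 * M, fun t ht => hwtop t ⟨(hδ.trans ht.1).le, ht.2.trans hT₁⟩⟩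
  obtain ⟨wc, q, hcl, hae⟩ :=
    hC hν hT hu₀3 hdiv hK.mild hK.continuousInLpOn hK.aestronglyMeasurable hbdd
  -- the bounds pass to the continuous representative
  have hB : ∀ t ∈ Ioo 0 T, ∀ x, ‖wc t x‖ ≤ 2 * M := fun t ht x =>
    norm_le_of_continuous_of_ae_eq (by positivity) (hcl.contDiff_velocity ht).continuous
      (hae t ht) (hwtop t ⟨ht.1.le, ht.2⟩) x
  have hL : ∀ t ∈ Ioo 0 T, eLpNorm (wc t) 2 volume ≤ 2 * eLpNorm u₀ 2 volume := fun t ht => by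
    rw [eLpNorm_congr_ae (hae t ht)]
    exact hwL2 t ⟨ht.1.le, ht.2⟩
  have hLt : 2 * eLpNorm u₀ 2 volume ≠ ⊤ :=
    ENNReal.mul_ne_top ENNReal.ofNat_ne_top hu₀.eLpNorm_ne_top
  -- the solution, reset to `u₀` at `t = 0`
  set v : ℝ → (EuclideanSpace ℝ (Fin 3)) → (EuclideanSpace ℝ (Fin 3)) := fun t x => if 0 < t then wc t x else u₀ x with hv_def
  have hvw : ∀ t ∈ Ioo 0 T, v t = wc t := fun t ht => funext fun x => if_pos ht.1
  have hv0 : v 0 = u₀ := funext fun x => if_neg (lt_irrefl 0)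
  have hvc : ContinuousInLpOn (Ico 0 T) 2 v := by
    refine hwc2.congr_ae_slice fun t ht => ?_
    rcases ht.1.eq_or_lt with h | h
    · rw [← h, hv0, hK.initial]
    · rw [hvw t ⟨h, ht.2⟩]
      exact (hae t ⟨h, ht.2⟩).symm
  exact ⟨v, q, hcl.congr_velocity hvw, fun T' hT' =>
    isLerayHopfOn_of_classical_Ioo hν hT'.1 hT'.2 hcl hvw hv0 hu₀ hvc hB hLt hL⟩

/-- **`leray_strong_local_existence` from the local analyticity of Oseen's scheme**
(Lemarié-Rieusset 2016, Thm. 9.12): composition with the tree's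
`classical_of_bounded_mild_L3_of_local_analyticity`. [cite: LemarieRieusset2016, Thm. 9.12 (PDF p. 260)] [cite: OzanskiPooley2018, Thm. 6.22] -/
theorem leray_strong_local_existence_of_local_analyticity
    (hA : lemarieRieusset2016_local_analyticity) : leray_strong_local_existence :=
  leray_strong_local_existence_of_classical_of_bounded_mild_L3
    (classical_of_bounded_mild_L3_of_local_analyticity hA)

/-- **`leray_strong_local_existence` from the KNSS local theory (L)** (Koch–Nadirashvili–
Seregin–Šverák 2009, Prop. 4.1 in quantitative short-time form): composition with the tree's
`classical_of_bounded_mild_L3_of_local`. [cite: KochNadirashviliSereginSverak2009, Prop. 4.1 (arXiv:0709.3599 p. 8)] [cite: OzanskiPooley2018, Thm. 6.22] -/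
theorem leray_strong_local_existence_of_knss2009_local_smoothing
    (hL : knss2009_local_smoothing (EuclideanSpace ℝ (Fin 3))) : leray_strong_local_existence :=
  leray_strong_local_existence_of_classical_of_bounded_mild_L3
    (classical_of_bounded_mild_L3_of_local hL)

/-- **Leray's blow-up rate from the smoothing of bounded mild solutions**: the dependency record
of `leray_blowup_rate_top` (Leray 1934, §19 (3.9); Ożański–Pooley 2018, Cor. 6.25) after this
file — `leray_blowup_rate_top_of_strong_local_existence` composed with the reduction. [cite: Leray1934, §19 (3.9) p. 224] [cite: OzanskiPooley2018, Cor. 6.25] -/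
theorem leray_blowup_rate_top_of_classical_of_bounded_mild_L3 (hC : classical_of_bounded_mild_L3) :
    leray_blowup_rate_top :=
  leray_blowup_rate_top_of_strong_local_existence
    (leray_strong_local_existence_of_classical_of_bounded_mild_L3 hC)

end Assembly

end Literature.Analysis.FluidPDE

end
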